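import Summits.HodgeConjecture.HodgeConjecture.Theses.HeckePrymWeil
import Summits.HodgeConjecture.HodgeConjecture.Theorems.HeckePrymWeilHeckePrymAnchorsOfStubs
import Summits.HodgeConjecture.HodgeConjecture.Theorems.HeckePrymWeilHeckePrymAnchorsUpgrade
import Summits.HodgeConjecture.HodgeConjecture.Theorems.HeckePrymWeilHeckePrymAnchorsRationalAlongSection
import Summits.HodgeConjecture.HodgeConjecture.Theorems.HeckePrymWeilHeckePrymAnchorsGlobalClassOfSection
import Literature.AlgebraicGeometry.HodgeTheory.WeilFamilyFlatSections
import Literature.AlgebraicGeometry.HodgeTheory.SemiregularVariationalHodge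
import Literature.AlgebraicGeometry.HodgeTheory.StandardChernCharacterBetti
import Literature.AlgebraicGeometry.HodgeTheory.ComplexConjugationHolds
import Literature.AlgebraicGeometry.HodgeTheory.AbelJacobiPullbackHodgeSection
import Literature.AlgebraicGeometry.HodgeTheory.HodgeTypeConjugation
import Literature.AlgebraicGeometry.HodgeTheory.GysinFormalismHodgeOfGysin
import Literature.AlgebraicGeometry.Motives.VarietiesGeometricallyIntegralProofs
import HarnessLib

/-!
# `WeilTenfoldsSqrtMinus11` by the Perry route (item stmt-HodgeConjecture-1262, route HeckePrymWeil)

Line `quaternionic-norm-anchors` of crux `HeckePrymWeil.WeilTenfoldsSqrtMinus11` (the Hodge–Weil classes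
of every complex abelian TENFOLD `A` with `φ ≫ φ = -11`, field `K = ℚ(√-11)`, type `(5,5)`, are algebraic),
skeleton v2 ("tensor-anchor reshape", lead c2, 2026-08-16), stub `stub_perryRouteComposition`: the line's
COMPOSITION `WeilTenfoldsSqrtMinus11_of` with its four registered open stubs turned into hypotheses —

1. Deligne's Weil family with a flat, fibrewise Hodge, Weil section and a tensor-isogenous fibre, the named
   fact `HodgeTheory.deligne1982_weilFamily_hodgeWeilSection` (Deligne, LNM 900, proof of Thm. 4.8 with
   Prop. 4.4; van Geemen LNM 1594 §5; André 1996 Lemme 6.3.3), used at `(p, k) = (11, 5)`;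
2. Perry's theorem, the named fact `HodgeTheory.Perry2026_semiregular_remainsAlgebraic` (arXiv:2604.00511
   Thm. 1.1 (2) ⊇ Buchweitz–Flenner 2003 Thm. 5.1): the Chern character of a `{0,1}`-semiregular vector
   bundle on one fibre of a smooth projective family over a smooth complex variety, once it lifts to a
   continuous Hodge-valued family of sections, is algebraic on EVERY fibre;
3. a standard Chern character on the real carriers, `Nonempty HodgeTheory.StandardChernCharacterBetti`
   (construction debt);
4. THE BET of the line (`stub_tensorAnchorObject`): on every `ℂ`-scheme `F₀ ≅ Y`, `(Y, Ψ)` an abelian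
   tenfold with `Ψ² = -11` and an isogeny pair towards a tensor point `(A₁ × A₁, (x,y) ↦ (-11y, x))`, and
   for every non-zero rational `(5,5)` class `x₀` of `F₀` landing in the strong Weil plane
   `weilClassesOf Y Ψ 5 11`, a finite locally free `{0,1}`-semiregular `E₀` with WEIL-PURE Chern character
   `ch(E₀) = r₀·1 + r·x₀`, `r ∈ ℚˣ` (all other `chₖ = 0`).

Contents:

* `sectionTransport_of_perry` — the ENGINE STEP in section form (proved outright from Perry's fact taken
  as a hypothesis): along a smooth projective family `f : 𝒳 ⟶ S` of relative dimension `10` over a smooth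
  irreducible quasi-projective base, a continuous section `σ` of the étalé space `FiberClass f 10` with
  rational `(5,5)` values whose value at ONE point `s₀` is, up to `r ∈ ℚ`, the degree-`10` Chern character
  of a `{0,1}`-semiregular vector bundle with Weil-pure Chern character `(r₀·1, 0, 0, 0, 0, r·σ(s₀), 0, …)`
  has `r·σ(s)` ALGEBRAIC on `X_s` for every `s` (Perry's fact fed with the Weil-pure family of sections;
  their continuity is that of global sections and of scalar multiples of `σ`, their values lie in the
  locus of Hodge classes because degree-`0` classes are `(0,0)`, `0` is `(k,k)` and `σ` is rational `(5,5)`);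
* `stub_perryRouteComposition` — the REGISTERED stub: hypotheses 1–4 imply the crux BY NAME. Proof:
  `c = 0` is algebraic; otherwise upgrade `c` to the strong Weil plane (`HeckePrymWeilLine.stub_upgrade`,
  proved), take Deligne's family through `A` with its section `σ` through `c` and its tensor-isogenous
  fibre `Y ≅ 𝒳_{s₀}` (hypothesis 1); `σ` is rational everywhere (`stub_rationalAlongSection`, proved) and
  `σ(s₀) = x ≠ 0` by the identity principle for continuous sections (`gcs_section_eq_of_eq`, proved: a
  section vanishing at `s₀` vanishes at `s₁`, but `σ(s₁) = e^{-1*}c ≠ 0`); hypothesis 3 gives a Chern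
  character, hypothesis 4 the Weil-pure semiregular `E₀` on `𝒳_{s₀}` with `ch₅(E₀) = r·x`;
  `sectionTransport_of_perry` (hypothesis 2) makes `r·σ(s₁) = r·e^{-1*}c` algebraic on `𝒳_{s₁}`; divide by
  `r ≠ 0` and pull back along `e : A ≅ 𝒳_{s₁}` (the route's proved `IsoInvariance`).

Design: the continuity of fibrewise scalar multiples of continuous sections of `FiberClass f k` is the
line's landed `HeckePrymWeil.TensorAnchor.stub_sectionSmul` (`Theorems/…StubSectionSmul`); this file
carries a PRIVATE copy (`tap_sectionSmul`) so as not to depend on that module's build state. The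
Weil-pure family of sections is packaged inside the proof as an existential with its three defining
equations (no definition is introduced). CONDITIONAL result: the trust base of the composition is exactly
its four hypotheses (two named facts of the tree, one construction, one open bet); nothing is asserted.
Deliberately NOT here: the engine-agnostic residue of the crux (`…OfWeilFamily`, landed), the bet itself,
any discharge of the two named facts.
-/

noncomputable section

-- single-problem summit (Problem = Summit): the mandated namespace repeats `HodgeConjecture`.
set_option linter.dupNamespace false

open CategoryTheory AlgebraicGeometry Limits MonoidalCategory CartesianMonoidalCategory
open Literature.AlgebraicGeometry Literature.AlgebraicGeometry.Motives
  Literature.AlgebraicGeometry.HodgeTheory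
open Literature.AlgebraicTopology.SingularHomology
open Summit.HodgeConjecture.HodgeConjecture.Theorems.HeckePrymWeilLine
  (stub_upgrade stub_rationalAlongSection gcs_section_eq_of_eq owf_isoTransport owf_anchorAlgebraic)

namespace Summit.HodgeConjecture.HodgeConjecture.Theorems.WeilTenfoldsSqrtMinus11.TensorAnchorPerry

/-! ## Infrastructure: scalar multiples of continuous sections of the étalé space (private copy) -/

/-- Fibrewise scalar multiples of continuous sections of the étalé space `FiberClass f k → S(ℂ)` of
`Rᵏ f_* ℂ` are continuous: the fibrewise map `(t, α) ↦ (t, r·α)` is continuous for the final topology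
`FiberClass.instTopologicalSpace` because it carries the local section of a tube class `ξ` to the local
section of `r·ξ` (`fiberRestrict` is linear). Private copy of the line's landed
`HeckePrymWeil.TensorAnchor.stub_sectionSmul`. [cite: Hartshorne1977, II Ex. 1.13] -/
private theorem tap_sectionSmul {𝒳 S : SchemeOver ℂ} (f : 𝒳 ⟶ S) (k : ℕ) (r : ℂ)
    (σ : ComplexPoints S → FiberClass f k) (hpt : ∀ s, (σ s).pt = s) (hσ : Continuous σ) :
    Continuous fun s => (⟨s, r • (σ s).clsAt (hpt s)⟩ : FiberClass f k) := by
  -- the fibrewise scalar multiplication on the étalé space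
  let sm : FiberClass f k → FiberClass f k := fun x => ⟨x.pt, r • x.cls⟩
  have hsm : Continuous sm := by
    refine continuous_iSup_dom.2 fun U => continuous_iSup_dom.2 fun ξ => continuous_coinduced_dom.2 ?_
    have heq : sm ∘ tubeSection f k (U : Set (ComplexPoints S)) ξ =
        tubeSection f k (U : Set (ComplexPoints S)) (r • ξ) := by
      funext t
      show (⟨(t : ComplexPoints S), r • fiberRestrict f t.2 k ξ⟩ : FiberClass f k) =
        ⟨(t : ComplexPoints S), fiberRestrict f t.2 k (r • ξ)⟩
      rw [map_smul]
    rw [heq]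
    exact continuous_tubeSection f k U (r • ξ)
  have key : ∀ (x : FiberClass f k) (s : ComplexPoints S) (h : x.pt = s),
      (⟨s, r • x.clsAt h⟩ : FiberClass f k) = sm x := by
    rintro ⟨_, _⟩ s h
    cases h
    rfl
  have heq : (fun s => (⟨s, r • (σ s).clsAt (hpt s)⟩ : FiberClass f k)) = sm ∘ σ :=
    funext fun s => key (σ s) s (hpt s)
  rw [heq]
  exact hsm.comp hσ

/-- Transport of rationality and Hodge type of a fibre class across an equality of base points
(`FiberClass.clsAt` is transport along `x.pt = s`). [folklore] -/
private theorem tap_clsAt_rational_hodge {𝒳 S : SchemeOver ℂ} {f : 𝒳 ⟶ S} {n k p : ℕ}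
    (x : FiberClass f k) (s : ComplexPoints S) (h : x.pt = s) (hr : IsRationalClass x.cls)
    (hh : IsOfHodgeType n (fiberOver f x.pt) k p p x.cls) :
    IsRationalClass (x.clsAt h) ∧ IsOfHodgeType n (fiberOver f s) k p p (x.clsAt h) := by
  obtain ⟨_, _⟩ := x
  cases h
  exact ⟨hr, hh⟩

/-! ## The engine step in section form: Weil transport from a Weil-pure `{0,1}`-semiregular object -/

/-- **Section-form Weil transport from a Weil-pure `{0,1}`-semiregular object** (Perry's fact `hP` taken
as a hypothesis). Along a smooth projective family `f : 𝒳 ⟶ S` of relative dimension `10` over a smooth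
irreducible quasi-projective base, let `σ` be a continuous section of `FiberClass f 10` with rational
`(5,5)` values. If at ONE point `s₀` there is a finite locally free `{0,1}`-semiregular `E₀` on the fibre
with `ch₀(E₀) = r₀·1`, `chₖ(E₀) = 0` (`k ≠ 0, 5`) and `ch₅(E₀) = r·σ(s₀)` in some Chern character theory
`C`, then `r·σ(s)` is ALGEBRAIC on `X_s` for EVERY `s`: Perry's theorem applied to the Weil-pure family of
sections `(r₀·1, 0, 0, 0, 0, r·σ, 0, …)` — continuous (global sections of `r₀·1` and of `0`, and scalar
multiples of `σ`), valued in the locus of Hodge classes (degree-`0` classes are `(0,0)`, `0` is `(k,k)`,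
`σ` is rational `(5,5)`), equal to `ch(E₀)` at `s₀`. The base is integral, being smooth (hence reduced)
and irreducible. [cite: Perry2026Semiregularity, Thm. 1.1 (2)] [cite: BuchweitzFlenner2003, Thm. 5.1] -/
theorem sectionTransport_of_perry (hP : Perry2026_semiregular_remainsAlgebraic)
    {𝒳 S : SchemeOver ℂ} (f : 𝒳 ⟶ S) (hf : IsSmoothProjectiveFamily f 10)
    (hirr : IrreducibleSpace S.left) (hS : AlgebraicGeometry.Smooth S.hom) (hSqp : IsQuasiProjectiveOver S)
    (σ : ComplexPoints S → FiberClass f (2 * 5)) (hσ : Continuous σ) (hpt : ∀ s, (σ s).pt = s)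
    (hrat : ∀ s, IsRationalClass (σ s).cls)
    (hH : ∀ s, IsOfHodgeType 10 (fiberOver f (σ s).pt) (2 * 5) 5 5 (σ s).cls)
    (s₀ : ComplexPoints S) (C : ChernCharacterBetti) (E₀ : (fiberOver f s₀).left.Modules)
    (hE₀ : IsFiniteLocallyFree E₀) (hsr : IsZeroOneSemiregular hE₀) (r₀ r : ℚ)
    (h0 : C.ch (fiberOver f s₀) E₀ 0 = ((r₀ : ℚ) : ℂ) •
      (singularCohomology.one ℂ (ComplexPoints (fiberOver f s₀)) : complexBetti (fiberOver f s₀) (2 * 0)))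
    (hk : ∀ k : ℕ, k ≠ 0 → k ≠ 5 → C.ch (fiberOver f s₀) E₀ k = 0)
    (h5 : C.ch (fiberOver f s₀) E₀ 5 = ((r : ℚ) : ℂ) • (σ s₀).clsAt (hpt s₀)) :
    ∀ s : ComplexPoints S, ((r : ℚ) : ℂ) • (σ s).clsAt (hpt s) ∈ algebraicClasses (fiberOver f s) 5 := by
  intro s
  haveI := hS
  haveI := hirr
  haveI : IsReduced S.left := isReduced_of_smooth_over_field S.hom
  have hint : IsIntegral S.left := isIntegral_of_irreducibleSpace_of_isReduced _
  -- the Weil-pure family of sections `(r₀·1, 0, 0, 0, 0, r·σ, 0, …)`, packaged with its defining equations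
  obtain ⟨w, hw5, hw0, hwo⟩ :
      ∃ w : (∀ (k : ℕ) (s : ComplexPoints S), complexBetti (fiberOver f s) (2 * k)),
        (∀ s, w 5 s = ((r : ℚ) : ℂ) • (σ s).clsAt (hpt s)) ∧
        (∀ s, w 0 s = ((r₀ : ℚ) : ℂ) •
          (singularCohomology.one ℂ (ComplexPoints (fiberOver f s)) :
            complexBetti (fiberOver f s) (2 * 0))) ∧
        (∀ k, k ≠ 0 → k ≠ 5 → ∀ s, w k s = 0) :=
    ⟨fun k s =>
      if h5 : k = 5 then h5 ▸ (((r : ℚ) : ℂ) • (σ s).clsAt (hpt s))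
      else if h0 : k = 0 then
        h0 ▸ (((r₀ : ℚ) : ℂ) •
          (singularCohomology.one ℂ (ComplexPoints (fiberOver f s)) :
            complexBetti (fiberOver f s) (2 * 0)))
      else 0,
    fun s => by
      beta_reduce
      rw [dif_pos rfl],
    fun s => by
      beta_reduce
      rw [dif_neg (by decide), dif_pos rfl],
    fun k hk0 hk5 s => by
      beta_reduce
      rw [dif_neg hk5, dif_neg hk0]⟩
  -- continuity
  have hwc : ∀ k, Continuous fun s => (⟨s, w k s⟩ : FiberClass f (2 * k)) := by
    intro k
    by_cases h5k : k = 5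
    · subst h5k
      have : (fun s => (⟨s, w 5 s⟩ : FiberClass f (2 * 5))) =
          fun s => (⟨s, ((r : ℚ) : ℂ) • (σ s).clsAt (hpt s)⟩ : FiberClass f (2 * 5)) := by
        funext s; rw [hw5 s]
      rw [this]
      exact tap_sectionSmul f (2 * 5) _ σ hpt hσ
    by_cases h0k : k = 0
    · subst h0k
      have : (fun s => (⟨s, w 0 s⟩ : FiberClass f (2 * 0))) =
          globalSection f (2 * 0) (((r₀ : ℚ) : ℂ) •
            (singularCohomology.one ℂ (ComplexPoints 𝒳) : complexBetti 𝒳 (2 * 0))) := by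
        funext s
        rw [hw0 s]
        show (⟨s, _⟩ : FiberClass f (2 * 0)) = ⟨s, _⟩
        congr 1
        rw [map_smul]
        congr 1
        exact (singularCohomology.map_one (Motives.AlgPoints.mapContinuous (L := ℂ) (fiberι f s))).symm
      rw [this]
      exact continuous_globalSection f (2 * 0) _
    · have : (fun s => (⟨s, w k s⟩ : FiberClass f (2 * k))) = globalSection f (2 * k) 0 := by
        funext s
        rw [hwo k h0k h5k s]
        show (⟨s, _⟩ : FiberClass f (2 * k)) = ⟨s, _⟩
        rw [map_zero]
      rw [this]
      exact continuous_globalSection f (2 * k) _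
  -- values in the locus of Hodge classes
  have hwH : ∀ k s, (⟨s, w k s⟩ : FiberClass f (2 * k)) ∈ locusOfHodgeClasses f 10 k := by
    intro k s
    rw [mem_locusOfHodgeClasses_iff]
    by_cases h5k : k = 5
    · subst h5k
      obtain ⟨hr', hh'⟩ := tap_clsAt_rational_hodge (σ s) s (hpt s) (hrat s) (hH s)
      refine ⟨?_, ?_⟩
      · rw [hw5 s]
        exact hr'.smul r
      · rw [hw5 s]
        exact hh'.smul _
    by_cases h0k : k = 0
    · subst h0k
      refine ⟨?_, ?_⟩
      · rw [hw0 s]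
        exact (isRationalClass_one _).smul r₀
      · exact isOfHodgeType_zero_zero_of_degree_zero (hf.isSmoothProjective s) _
    · obtain ⟨M⟩ := (nonempty_hodgeModel_holds (n := 10) (X := fiberOver f s)).nonempty
        (hf.isSmoothProjective s)
      rw [hwo k h0k h5k s]
      exact ⟨IsRationalClass.zero, IsOfHodgeType.zero M _ _ _⟩
  -- the values at `s₀` are the Chern character of `E₀`
  have hw₀ : ∀ k, w k s₀ = C.ch (fiberOver f s₀) E₀ k := by
    intro k
    by_cases h5k : k = 5
    · subst h5k
      rw [hw5 s₀, h5]
    by_cases h0k : k = 0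
    · subst h0k
      rw [hw0 s₀, h0]
    · rw [hwo k h0k h5k s₀, hk k h0k h5k]
  -- Perry
  have h := hP C f 10 hf hSqp hint hS w hwc hwH s₀ E₀ hE₀ hsr hw₀ s 5
  rwa [hw5 s] at h

/-! ## The composition: the four open stubs of the line imply the crux, BY NAME -/

/-- **Stub `stub_perryRouteComposition` (registered): `WeilTenfoldsSqrtMinus11` from the four open stubs
of the line** — Deligne's Weil family `deligne1982_weilFamily_hodgeWeilSection` (named fact), Perry's
theorem `Perry2026_semiregular_remainsAlgebraic` (named fact), a standard Chern character on the real
carriers (`Nonempty StandardChernCharacterBetti`), and THE BET (a Weil-pure `{0,1}`-semiregular vector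
bundle through every non-zero rational `(5,5)` class of the strong Weil plane of every tensor-isogenous
`√-11` tenfold, typed on any `ℂ`-scheme `F₀ ≅ Y`). Given `(A, φ)` and a rational `(5,5)` class `c` of the
literal Weil plane: `c = 0` is algebraic. Otherwise upgrade `c` to the strong plane (`stub_upgrade`), take
Deligne's family `f : 𝒳 → S` through `A ≅ 𝒳_{s₁}` with its continuous fibrewise-Hodge section `σ` through
`c` and its tensor-isogenous fibre `Y ≅ 𝒳_{s₀}`, `σ(s₀) = x` in the strong Weil plane of `(Y, Ψ)`; `σ` is
rational everywhere (`stub_rationalAlongSection`) and `x ≠ 0` (identity principle `gcs_section_eq_of_eq`: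
a continuous section vanishing at `s₀` vanishes at `s₁`, but `σ(s₁) = e^{-1*}c ≠ 0`); the bet gives the
Weil-pure semiregular `E₀` on `𝒳_{s₀}` with `ch₅(E₀) = r·x`, `r ≠ 0`; `sectionTransport_of_perry` makes
`r·σ(s₁) = r·e^{-1*}c` algebraic on `𝒳_{s₁}`; divide by `r` and pull back along `e` (`IsoInvariance`).
CONDITIONAL on exactly its four hypotheses.
[cite: Deligne1982HodgeCycles, proof of Thm. 4.8 (pp. 47–52) with Prop. 4.4, Lemma 4.5, Remark 4.10]
[cite: Perry2026Semiregularity, Thm. 1.1 (2)] [cite: BuchweitzFlenner2003, Thm. 5.1]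
[cite: Markman2025SecantWeil, §1.2 and Thm. 1.5.1] -/
theorem stub_perryRouteComposition : deligne1982_weilFamily_hodgeWeilSection → Perry2026_semiregular_remainsAlgebraic → Nonempty StandardChernCharacterBetti → (∀ (C : StandardChernCharacterBetti) (Y : AbelianVariety ℂ) (Ψ : Y ⟶ Y) (A₁ : AbelianVariety ℂ) (f₁ : Y ⟶ A₁.prod A₁) (g₁ : A₁.prod A₁ ⟶ Y) (m : ℕ), A₁.dim = 5 → Y.dim = 10 → Ψ ≫ Ψ = -((11 : ℤ) • 𝟙 Y) → 0 < m → f₁ ≫ g₁ = m • 𝟙 Y → AlgebraicGeometry.Flat f₁.hom.hom.hom.left → g₁ ≫ Ψ = AbelianVariety.prodLift (AbelianVariety.snd A₁ A₁ ≫ (-((11 : ℤ) • 𝟙 A₁))) (AbelianVariety.fst A₁ A₁) ≫ g₁ → ∀ (F₀ : SchemeOver ℂ) (e₀ : Y.X ≅ F₀) (x₀ : complexBetti F₀ (2 * 5)), IsRationalClass x₀ → IsOfHodgeType 10 F₀ (2 * 5) 5 5 x₀ → complexBetti.map e₀.hom (2 * 5) x₀ ∈ weilClassesOf Y Ψ 5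 11 → x₀ ≠ 0 → ∃ (E₀ : F₀.left.Modules) (hE₀ : IsFiniteLocallyFree E₀), IsZeroOneSemiregular hE₀ ∧ ∃ (r₀ r : ℚ), r ≠ 0 ∧ C.ch F₀ E₀ 0 = ((r₀ : ℚ) : ℂ) • (singularCohomology.one ℂ (ComplexPoints F₀) : complexBetti F₀ (2 * 0)) ∧ (∀ k : ℕ, k ≠ 0 → k ≠ 5 → C.ch F₀ E₀ k = 0) ∧ C.ch F₀ E₀ 5 = ((r : ℚ) : ℂ) • x₀) → Summit.HodgeConjecture.HodgeConjecture.Theses.HeckePrymWeil.WeilTenfoldsSqrtMinus11 := by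
  intro hWF hP hC hB A φ hA hφ c hr hH hW
  by_cases hc : c = 0
  · rw [hc]
    exact Submodule.zero_mem _
  -- casts: the named fact is stated for a variable prime `p`, here `p = 11`, at degree `2 * 5`
  have hφ' : φ ≫ φ = -(((11 : ℕ) : ℤ) • 𝟙 A) := by exact_mod_cast hφ
  have hA' : A.dim = 2 * 5 := hA
  -- typing upgrade (proved): the single-operator plane lies in the strong Weil plane
  have hcW : c ∈ weilClassesOf A φ 5 11 := by
    refine stub_upgrade 11 (by norm_num) (by norm_num) (by norm_num) 5 A φ hA' hφ' ?_
    exact_mod_cast hW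
  -- hypothesis 1: Deligne's Weil family through `A`, section through `c`, tensor-isogenous fibre
  obtain ⟨𝒳, S, f, s₁, s₀, e, σ, hfam, -, hirr, hsmooth, hSqp, -, hσ, hpt, hHσ, hs₁, Y, Ψ, e₀, x,
    ⟨A₁, f₁, g₁, m, hA₁, hY, hΨ, hm, hfg, hf₁, hg₁⟩, hs₀, hx⟩ :=
    hWF 11 (by norm_num) (by norm_num) (by norm_num) 5 (by norm_num) A φ hA' hφ' c hcW hc hr hH
  -- rationality along the section (proved)
  have hrat₁ : IsRationalClass (σ s₁).cls := by
    rw [hs₁]; exact hr.map _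
  have hratσ : ∀ s, IsRationalClass (σ s).cls :=
    stub_rationalAlongSection f (2 * 5) (2 * 5) hfam hsmooth hSqp hirr σ hσ hpt s₁ hrat₁
  have hratx : IsRationalClass x := by
    have h := hratσ s₀
    rwa [hs₀] at h
  have hHx : IsOfHodgeType 10 (fiberOver f s₀) (2 * 5) 5 5 x := by
    have h := hHσ s₀
    rw [hs₀] at h
    exact h
  -- `x ≠ 0`: a continuous section vanishing at `s₀` vanishes identically (identity principle, proved)
  have hx0 : x ≠ 0 := by
    intro hx0
    haveI := hsmooth
    haveI := hirr
    haveI : LocallyOfFiniteType S.hom := hSqp.locallyOfFiniteType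
    haveI : ConnectedSpace (ComplexPoints S) :=
      (ComplexPoints.connectedSpace_iff_holds S).2 inferInstance
    obtain ⟨d, hd⟩ := exists_smoothOfRelativeDimension_of_connectedSpace_complexPoints S
    haveI := hd
    haveI := pathConnectedSpace_complexPoints_of_smoothOfRelativeDimension S d
    have hU := isCohomologicallyLocallyTrivialOn_univ_of_isSmoothProjectiveFamily f d hfam hSqp
    have hzero : σ s₀ = globalSection f (2 * 5) 0 s₀ := by
      rw [hs₀, hx0]
      show (⟨s₀, 0⟩ : FiberClass f (2 * 5)) = ⟨s₀, _⟩
      rw [map_zero]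
    have hall := gcs_section_eq_of_eq f (2 * 5) hU hσ hpt (continuous_globalSection f _ 0)
      (fun _ => rfl) hzero s₁
    rw [hs₁] at hall
    have hc' : complexBetti.map e.inv (2 * 5) c = 0 := by
      have h2 := ((FiberClass.clsAt_eq_iff _ rfl _).2 hall.symm).symm
      -- `h2 : e.inv^* c = (globalSection f 10 0 s₁).clsAt rfl`
      rw [h2]
      show complexBetti.map (fiberι f s₁) (2 * 5) 0 = 0
      rw [map_zero]
    apply hc
    have h3 := congrArg (complexBetti.map e.hom (2 * 5)) hc'
    rwa [map_zero, ← CategoryTheory.comp_apply, ← complexBetti.map_comp, Iso.hom_inv_id,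
      complexBetti.map_id, CategoryTheory.id_apply] at h3
  -- hypothesis 3: a standard Chern character
  obtain ⟨C⟩ := hC
  -- hypothesis 4 (the bet): the Weil-pure semiregular object on the fibre `X_{s₀} ≅ Y`
  obtain ⟨E₀, hE₀, hsr, r₀, r, hr0, h0, hk, h5⟩ :=
    hB C Y Ψ A₁ f₁ g₁ m hA₁ hY (by exact_mod_cast hΨ) hm hfg hf₁ (by exact_mod_cast hg₁)
      (fiberOver f s₀) e₀ x hratx hHx hx hx0
  have h5' : C.ch (fiberOver f s₀) E₀ 5 = ((r : ℚ) : ℂ) • (σ s₀).clsAt (hpt s₀) := by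
    rw [h5, (FiberClass.clsAt_eq_iff _ _ _).2 hs₀]
  -- hypothesis 2 through the engine step: `r·σ` is algebraic everywhere, in particular over `s₁`
  have halg := sectionTransport_of_perry hP f hfam hirr hsmooth hSqp σ hσ hpt hratσ hHσ s₀
    C.toChernCharacterBetti E₀ hE₀ hsr r₀ r h0 hk h5' s₁
  rw [(FiberClass.clsAt_eq_iff _ _ _).2 hs₁] at halg
  have hrC : ((r : ℚ) : ℂ) ≠ 0 := by exact_mod_cast hr0
  have h1 : complexBetti.map e.inv (2 * 5) c ∈ algebraicClasses (fiberOver f s₁) 5 :=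
    (Submodule.smul_mem_iff _ hrC).mp halg
  -- back along `e : A ≅ 𝒳_{s₁}` (the route's proved `IsoInvariance`)
  have key := Theorems.isoInvariance_proof e 5 _ h1
  rw [← CategoryTheory.comp_apply, ← complexBetti.map_comp, Iso.hom_inv_id,
    complexBetti.map_id] at key
  exact key

end Summit.HodgeConjecture.HodgeConjecture.Theorems.WeilTenfoldsSqrtMinus11.TensorAnchorPerry

end
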